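import Literature.Probability.LatticeModels.InnerFacesHoleFree
import Literature.Probability.LatticeModels.WeakBeurlingEstimate
import HarnessLib

/-!
# Peeling cells off a lattice region: hole-freeness under removal, extremal cells

Topic `Literature/Probability/LatticeModels`; groundwork for the boundary normalisation of the
Kadanoff–Ceva primitive (Chelkak–Hongler–Izyurov 2015, Prop. 3.6 (ii): `H = 0` on the boundary of a
simply connected discrete domain, which in the tree requires that the frozen boundary ring of a
hole-free connected volume be connected — to be proved by peeling cells, `KCPrimitiveFrozen.lean`).
This file provides the two elementary ingredients of the peeling induction:

* `holeFree_sdiff_singleton_of_exit`: removing from a hole-free set `P` (`HoleFree`,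
  `HoleFreePotential.lean`) a cell that has a lattice neighbour outside `P` keeps it hole-free;
* `exists_lexMax` / `lexMax_exits`: a nonempty finite set of cells has a lexicographically maximal
  cell (maximal row, then maximal column), and the cells above it and to its right are outside.

Everything is proved; no named fact.

## References

* D. Chelkak, C. Hongler, K. Izyurov, Ann. of Math. 181 (2015): §2.1 (simply connected discrete
  domains), Prop. 3.6 (ii) [ChelkakHonglerIzyurovAnnals2015].
-/

noncomputable section

namespace Literature.Probability.LatticeModels

open Finset

/-- **Removing a cell with an exit keeps hole-freeness**: if `t ∈ P` has a lattice neighbour outside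
`P` and `P` is hole-free, so is `P ∖ {t}`. [folklore] -/
theorem holeFree_sdiff_singleton_of_exit {P : Set (Site 2)} (hP : HoleFree P) {t : Site 2}
    (hexit : ∃ k : Fin 4, t + cornerUnit k ∉ P) : HoleFree (P \ {t}) := by
  intro g hg M
  have hmono : ∀ a b : Site 2, Relation.ReflTransGen (FaceStep P) a b → Relation.ReflTransGen (FaceStep (P \ {t})) a b :=
    fun a b h => Relation.ReflTransGen.mono (fun _ _ h => FaceStep.mono Set.sdiff_subset h) _ _ h
  by_cases hgt : g = t
  · subst hgt
    obtain ⟨k, hk⟩ := hexit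
    obtain ⟨g', hM, hreach⟩ := hP (g + cornerUnit k) hk M
    refine ⟨g', hM, Relation.ReflTransGen.head ?_ (hmono _ _ hreach)⟩
    exact ⟨cSrc_mem_edgeSet (g, k), hg, fun h => hk h.1⟩
  · have hgP : g ∉ P := fun h => hg ⟨h, hgt⟩
    obtain ⟨g', hM, hreach⟩ := hP g hgP M
    exact ⟨g', hM, hmono _ _ hreach⟩

/-- The lexicographic key (row, then column). [folklore] -/
def lexKey (s : Site 2) : ℤ ×ₗ ℤ := toLex (s 1, s 0)

/-- **A nonempty finite set of cells has a lexicographically maximal cell.** [folklore] -/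
theorem exists_lexMax (Λ : Finset (Site 2)) (hΛ : Λ.Nonempty) :
    ∃ s ∈ Λ, ∀ u ∈ Λ, u 1 < s 1 ∨ (u 1 = s 1 ∧ u 0 ≤ s 0) := by
  obtain ⟨s, hs, hmax⟩ := Λ.exists_max_image lexKey hΛ
  refine ⟨s, hs, fun u hu => ?_⟩
  have h := hmax u hu
  simp only [lexKey, Prod.Lex.toLex_le_toLex] at h
  rcases h with h | ⟨h1, h0⟩
  · exact Or.inl h
  · exact Or.inr ⟨h1, h0⟩

/-- **Exits of the lexicographically maximal cell**: the cells above it and to its right are outside,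
and so is the cell above its left neighbour. [folklore] -/
theorem lexMax_exits {Λ : Finset (Site 2)} {s : Site 2} (hmax : ∀ u ∈ Λ, u 1 < s 1 ∨ (u 1 = s 1 ∧ u 0 ≤ s 0)) :
    s + cornerUnit 1 ∉ Λ ∧ s + cornerUnit 0 ∉ Λ ∧ s + cornerUnit 2 + cornerUnit 1 ∉ Λ := by
  refine ⟨fun h => ?_, fun h => ?_, fun h => ?_⟩
  · rcases hmax _ h with h1 | ⟨h1, -⟩
    · simp [cornerUnit] at h1
    · simp [cornerUnit] at h1
  · rcases hmax _ h with h1 | ⟨-, h0⟩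
    · simp [cornerUnit] at h1
    · simp [cornerUnit] at h0
  · rcases hmax _ h with h1 | ⟨h1, -⟩
    · simp [cornerUnit] at h1
    · simp [cornerUnit] at h1

/-! ### Connectivity inside a finite set of cells -/

/-- A lattice step inside `Λ`. [folklore] -/
def InStep (Λ : Finset (Site 2)) (a b : Site 2) : Prop := (zdGraph 2).Adj a b ∧ a ∈ Λ ∧ b ∈ Λ

/-- **`Λ` is lattice-connected**: any two cells of `Λ` are joined by lattice steps inside `Λ`. [folklore] -/
def LConn (Λ : Finset (Site 2)) : Prop := ∀ u ∈ Λ, ∀ v ∈ Λ, Relation.ReflTransGen (InStep Λ) u v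

/-- Steps inside a subset are steps inside the superset. [folklore] -/
theorem InStep.mono {Λ Λ' : Finset (Site 2)} (h : Λ ⊆ Λ') {a b : Site 2} (hs : InStep Λ a b) : InStep Λ' a b :=
  ⟨hs.1, h hs.2.1, h hs.2.2⟩

/-- Reachability inside a subset gives reachability inside the superset. [folklore] -/
theorem lreach_mono {Λ Λ' : Finset (Site 2)} (h : Λ ⊆ Λ') {a b : Site 2} (hr : Relation.ReflTransGen (InStep Λ) a b) :
    Relation.ReflTransGen (InStep Λ') a b :=
  Relation.ReflTransGen.mono (fun _ _ hs => InStep.mono h hs) _ _ hr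

/-- `InStep` is symmetric. [folklore] -/
theorem InStep.symm {Λ : Finset (Site 2)} {a b : Site 2} (hs : InStep Λ a b) : InStep Λ b a := ⟨hs.1.symm, hs.2.2, hs.2.1⟩

/-- Reachability inside `Λ` is symmetric. [folklore] -/
theorem lreach_symm {Λ : Finset (Site 2)} {a b : Site 2} (hr : Relation.ReflTransGen (InStep Λ) a b) :
    Relation.ReflTransGen (InStep Λ) b a := by
  induction hr with
  | refl => exact Relation.ReflTransGen.refl
  | tail _ hbc ih => exact Relation.ReflTransGen.head hbc.symm ih

/-- The endpoints of a nontrivial reachability lie in `Λ`. [folklore] -/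
theorem lreach_mem {Λ : Finset (Site 2)} {a b : Site 2} (hr : Relation.ReflTransGen (InStep Λ) a b) (hab : a ≠ b) : a ∈ Λ ∧ b ∈ Λ := by
  induction hr with
  | refl => exact absurd rfl hab
  | @tail c d hac hcd ih =>
    refine ⟨?_, hcd.2.2⟩
    by_cases hac' : a = c
    · exact hac' ▸ hcd.2.1
    · exact (ih hac').1

/-- A singleton is lattice-connected. [folklore] -/
theorem lconn_singleton (v : Site 2) : LConn {v} := by
  intro u hu w hw
  rw [Finset.mem_singleton] at hu hw
  subst hu; subst hw
  exact Relation.ReflTransGen.refl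

/-- Connectivity from a hub: if every cell of `Λ` is reachable from `a` inside `Λ`, then `Λ` is
lattice-connected. [folklore] -/
theorem lconn_of_hub {Λ : Finset (Site 2)} {a : Site 2} (h : ∀ u ∈ Λ, Relation.ReflTransGen (InStep Λ) a u) : LConn Λ :=
  fun u hu v hv => (lreach_symm (h u hu)).trans (h v hv)

/-- **Adding a cell adjacent to a connected set keeps it connected.** [folklore] -/
theorem lconn_insert_of_adj {S : Finset (Site 2)} (hS : LConn S) {s a : Site 2} (ha : a ∈ S) (hadj : (zdGraph 2).Adj s a) :
    LConn (insert s S) := by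
  have hsub : S ⊆ insert s S := Finset.subset_insert s S
  refine lconn_of_hub (a := a) fun u hu => ?_
  rcases Finset.mem_insert.1 hu with rfl | hu
  · exact Relation.ReflTransGen.single ⟨hadj.symm, hsub ha, Finset.mem_insert_self _ _⟩
  · exact lreach_mono hsub (hS a ha u hu)

/-- **Joining two connected sets through a common neighbour.** [folklore] -/
theorem lconn_insert_union {S₁ S₂ : Finset (Site 2)} (h1 : LConn S₁) (h2 : LConn S₂) {s a b : Site 2} (ha : a ∈ S₁) (hb : b ∈ S₂)
    (h1a : (zdGraph 2).Adj s a) (h2b : (zdGraph 2).Adj s b) : LConn (insert s (S₁ ∪ S₂)) := by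
  have hsub1 : S₁ ⊆ insert s (S₁ ∪ S₂) := fun z hz => Finset.mem_insert_of_mem (Finset.mem_union_left _ hz)
  have hsub2 : S₂ ⊆ insert s (S₁ ∪ S₂) := fun z hz => Finset.mem_insert_of_mem (Finset.mem_union_right _ hz)
  have hs : s ∈ insert s (S₁ ∪ S₂) := Finset.mem_insert_self _ _
  refine lconn_of_hub (a := s) fun u hu => ?_
  rcases Finset.mem_insert.1 hu with rfl | hu
  · exact Relation.ReflTransGen.refl
  · rcases Finset.mem_union.1 hu with hu | hu
    · exact Relation.ReflTransGen.head ⟨h1a, hs, hsub1 ha⟩ (lreach_mono hsub1 (h1 a ha u hu))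
    · exact Relation.ReflTransGen.head ⟨h2b, hs, hsub2 hb⟩ (lreach_mono hsub2 (h2 b hb u hu))

/-- **Cutting a path at the first visit of a cell**: if `u ≠ s` reaches `s` inside `Λ`, then `u`
reaches, inside `Λ ∖ {s}`, a cell of `Λ` adjacent to `s`. [folklore] -/
theorem lreach_erase_neighbour {Λ : Finset (Site 2)} {u s : Site 2} (hr : Relation.ReflTransGen (InStep Λ) u s) (hus : u ≠ s) :
    ∃ n ∈ Λ, (zdGraph 2).Adj n s ∧ Relation.ReflTransGen (InStep (Λ.erase s)) u n := by
  induction hr using Relation.ReflTransGen.head_induction_on with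
  | refl => exact absurd rfl hus
  | @head a c hac _ ih =>
    by_cases hcs : c = s
    · subst hcs
      exact ⟨a, hac.2.1, hac.1, Relation.ReflTransGen.refl⟩
    · obtain ⟨n, hn, hadj, hreach⟩ := ih hcs
      exact ⟨n, hn, hadj, Relation.ReflTransGen.head ⟨hac.1, Finset.mem_erase.2 ⟨hus, hac.2.1⟩, Finset.mem_erase.2 ⟨hcs, hac.2.2⟩⟩ hreach⟩

open scoped Classical in
/-- A path inside `Λ` from `a` stays inside the set of cells reachable from `a`. [folklore] -/
theorem lreach_filter {Λ : Finset (Site 2)} {a u : Site 2} (hr : Relation.ReflTransGen (InStep Λ) a u) :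
    Relation.ReflTransGen (InStep (Λ.filter fun z => Relation.ReflTransGen (InStep Λ) a z)) a u := by
  induction hr with
  | refl => exact Relation.ReflTransGen.refl
  | @tail c d hac hcd ih =>
    refine ih.tail ⟨hcd.1, Finset.mem_filter.2 ⟨hcd.2.1, hac⟩, Finset.mem_filter.2 ⟨hcd.2.2, hac.tail hcd⟩⟩


/-! ### The peeling theorem -/


/-- Translating a cell by a nonzero lattice vector moves it. [folklore] -/
theorem add_cornerUnit_ne_self (s : Site 2) (k : Fin 4) : s + cornerUnit k ≠ s := by
  intro h
  have : cornerUnit k = 0 := by simpa using h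
  exact cornerUnit_ne_zero k this

/-- `s + e₂ + e₃ ≠ s`, `s + e₂ + e₃ ≠ s + e₃`, `s + e₂ + e₃ ≠ s + e₂`. [folklore] -/
theorem diag_ne (s : Site 2) :
    s + cornerUnit 2 + cornerUnit 3 ≠ s ∧ s + cornerUnit 2 + cornerUnit 3 ≠ s + cornerUnit 3 ∧
      s + cornerUnit 2 + cornerUnit 3 ≠ s + cornerUnit 2 := by
  refine ⟨fun h => ?_, fun h => ?_, fun h => ?_⟩
  · have : cornerUnit 2 + cornerUnit 3 = (0 : Site 2) := by
      have := congrArg (fun z => z - s) h; simpa [add_assoc] using this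
    exact absurd this (by decide)
  · have : cornerUnit 2 = (0 : Site 2) := by
      have := congrArg (fun z => z - s - cornerUnit 3) h; simpa [add_assoc, add_comm, add_left_comm] using this
    exact cornerUnit_ne_zero 2 this
  · exact add_cornerUnit_ne_self _ 3 h

/-- **The peeling theorem.** In a finite lattice-connected set of at least two cells, for every cell
`x` there is a cell `t ≠ x` with a lattice neighbour outside the set whose removal keeps the set
lattice-connected. (Proof: let `s` be the lexicographically maximal cell; if `s` is not a cut cell
it can be removed, and otherwise the two components of the rest each contain such a cell, by
induction.) [folklore] -/
theorem peeling : ∀ (n : ℕ) (Λ : Finset (Site 2)), Λ.card = n → LConn Λ → 2 ≤ Λ.card →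
    ∀ x : Site 2, ∃ t ∈ Λ, t ≠ x ∧ (∃ k : Fin 4, t + cornerUnit k ∉ Λ) ∧ LConn (Λ.erase t) := by
  intro n
  induction n using Nat.strong_induction_on with
  | _ n IH =>
  intro Λ hcard hconn h2 x
  classical
  have hne : Λ.Nonempty := Finset.card_pos.1 (by omega)
  obtain ⟨s, hs, hmax⟩ := exists_lexMax Λ hne
  obtain ⟨Eup, Eright, Eupleft⟩ := lexMax_exits hmax
  set ℓ := s + cornerUnit 2 with hℓdef
  set d := s + cornerUnit 3 with hddef
  set Λ' := Λ.erase s with hΛ'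
  have hcard' : Λ'.card = n - 1 := by rw [hΛ', Finset.card_erase_of_mem hs, hcard]
  have adj_sℓ : (zdGraph 2).Adj s ℓ := zdGraph_adj_add_cornerUnit s 2
  have adj_sd : (zdGraph 2).Adj s d := zdGraph_adj_add_cornerUnit s 3
  -- the `Λ`-neighbours of `s` are among `ℓ`, `d`
  have hnbr : ∀ m ∈ Λ, (zdGraph 2).Adj s m → m = ℓ ∨ m = d := by
    intro m hm hadj
    obtain ⟨k, rfl⟩ := WeakBeurling.exists_eq_add_cornerUnit_of_adj hadj
    fin_cases k
    · exact absurd hm Eright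
    · exact absurd hm Eup
    · exact Or.inl rfl
    · exact Or.inr rfl
  -- every cell of `Λ'` reaches `ℓ` or `d` inside `Λ'`, and `s` has a neighbour in `Λ`
  have hcover : ∀ u ∈ Λ', Relation.ReflTransGen (InStep Λ') ℓ u ∨ Relation.ReflTransGen (InStep Λ') d u := by
    intro u hu
    obtain ⟨hus, huΛ⟩ := Finset.mem_erase.1 hu
    obtain ⟨m, hm, hadj, hreach⟩ := lreach_erase_neighbour (hconn u huΛ s hs) hus
    rcases hnbr m hm hadj.symm with rfl | rfl
    · exact Or.inl (lreach_symm hreach)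
    · exact Or.inr (lreach_symm hreach)
  have hsnbr : ∃ m ∈ Λ, (zdGraph 2).Adj s m := by
    obtain ⟨u, hu, hus⟩ : ∃ u ∈ Λ, u ≠ s := by
      by_contra hall
      push Not at hall
      have : Λ ⊆ {s} := fun z hz => Finset.mem_singleton.2 (hall z hz)
      have := Finset.card_le_card this
      rw [Finset.card_singleton] at this
      omega
    obtain ⟨m, hm, hadj, -⟩ := lreach_erase_neighbour (hconn u hu s hs) hus
    exact ⟨m, hm, hadj.symm⟩
  by_cases hcut : LConn Λ'
  · ----------------------------------------------------------------- `s` is not a cut cell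
    by_cases hxs : x = s
    · by_cases hc1 : Λ'.card = 1
      · -- `Λ = {s, m}`
        obtain ⟨m, hm⟩ := Finset.card_eq_one.1 hc1
        obtain ⟨m', hm', hadj'⟩ := hsnbr
        have hm'Λ' : m' ∈ Λ' := Finset.mem_erase.2 ⟨hadj'.ne.symm, hm'⟩
        rw [hm, Finset.mem_singleton] at hm'Λ'
        subst hm'Λ'
        have herase : Λ.erase m' = {s} := by
          ext z
          simp only [Finset.mem_erase, Finset.mem_singleton]
          constructor
          · rintro ⟨hzm, hz⟩
            by_contra hzx
            have : z ∈ Λ' := Finset.mem_erase.2 ⟨hzx, hz⟩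
            rw [hm, Finset.mem_singleton] at this
            exact hzm this
          · rintro rfl
            exact ⟨hadj'.ne, hs⟩
        refine ⟨m', hm', fun h => hadj'.ne.symm (h.trans hxs), ?_, by rw [herase]; exact lconn_singleton s⟩
        rcases hnbr m' hm' hadj' with rfl | rfl
        · exact ⟨1, Eupleft⟩
        · refine ⟨2, fun hc => ?_⟩
          -- `d + e₂ = s + e₂ + e₃ ∉ Λ = {s, d}`
          have hcΛ' : s + cornerUnit 3 + cornerUnit 2 ∈ Λ' := by
            refine Finset.mem_erase.2 ⟨?_, hc⟩
            rw [add_right_comm]; exact (diag_ne s).1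
          rw [hm, Finset.mem_singleton, add_right_comm] at hcΛ'
          exact (diag_ne s).2.1 hcΛ'
      · -- `Λ'` has at least two cells: induct
        have h2' : 2 ≤ Λ'.card := by
          have : 1 ≤ Λ'.card := by rw [hcard']; omega
          omega
        have hlt : n - 1 < n := by omega
        obtain ⟨t, htΛ', htx', ⟨k, hk⟩, hconn''⟩ :=
          IH (n - 1) hlt Λ' hcard' hcut h2' (if d ∈ Λ then d else ℓ)
        obtain ⟨hts, htΛ⟩ := Finset.mem_erase.1 htΛ'
        refine ⟨t, htΛ, fun h => hts (h.trans hxs), ?_, ?_⟩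
        · -- exit
          by_cases hkΛ : t + cornerUnit k ∈ Λ
          · have hks : t + cornerUnit k = s := by
              by_contra hne; exact hk (Finset.mem_erase.2 ⟨hne, hkΛ⟩)
            have hadj : (zdGraph 2).Adj s t := by rw [← hks]; exact (zdGraph_adj_add_cornerUnit t k).symm
            rcases hnbr t htΛ hadj with rfl | rfl
            · exact ⟨1, Eupleft⟩
            · exfalso; rw [if_pos htΛ] at htx'; exact htx' rfl
          · exact ⟨k, hkΛ⟩
        · -- connectivity of `Λ ∖ {t} = insert s (Λ' ∖ {t})`
          have heq : Λ.erase t = insert s (Λ'.erase t) := by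
            ext z
            simp only [Finset.mem_erase, Finset.mem_insert, hΛ']
            constructor
            · rintro ⟨hzt, hz⟩
              by_cases hzs : z = s
              · exact Or.inl hzs
              · exact Or.inr ⟨hzt, hzs, hz⟩
            · rintro (rfl | ⟨hzt, -, hz⟩)
              · exact ⟨fun h => hts h.symm, hs⟩
              · exact ⟨hzt, hz⟩
          rw [heq]
          by_cases hdΛ : d ∈ Λ
          · rw [if_pos hdΛ] at htx'
            exact lconn_insert_of_adj hconn'' (Finset.mem_erase.2 ⟨fun h => htx' h.symm, Finset.mem_erase.2 ⟨(adj_sd.ne).symm, hdΛ⟩⟩) adj_sd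
          · rw [if_neg hdΛ] at htx'
            obtain ⟨m, hm, hadj⟩ := hsnbr
            have hmℓ : m = ℓ := by
              rcases hnbr m hm hadj with h | h
              · exact h
              · exact absurd (h ▸ hm) hdΛ
            subst hmℓ
            exact lconn_insert_of_adj hconn'' (Finset.mem_erase.2 ⟨fun h => htx' h.symm, Finset.mem_erase.2 ⟨(adj_sℓ.ne).symm, hm⟩⟩) adj_sℓ
    · exact ⟨s, hs, fun h => hxs h.symm, ⟨1, Eup⟩, hcut⟩
  · ----------------------------------------------------------------- `s` is a cut cell
    -- `ℓ, d ∈ Λ` and they are not connected in `Λ'`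
    have hubℓ : ℓ ∉ Λ → LConn Λ' := by
      intro hℓ
      refine lconn_of_hub (a := d) fun u hu => ?_
      rcases hcover u hu with h | h
      · exfalso
        rcases eq_or_ne ℓ u with rfl | hne
        · exact hℓ (Finset.mem_erase.1 hu).2
        · exact hℓ (Finset.mem_erase.1 (lreach_mem h hne).1).2
      · exact h
    have hubd : d ∉ Λ → LConn Λ' := by
      intro hd
      refine lconn_of_hub (a := ℓ) fun u hu => ?_
      rcases hcover u hu with h | h
      · exact h
      · exfalso
        rcases eq_or_ne d u with rfl | hne
        · exact hd (Finset.mem_erase.1 hu).2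
        · exact hd (Finset.mem_erase.1 (lreach_mem h hne).1).2
    have hℓ : ℓ ∈ Λ := by by_contra h; exact hcut (hubℓ h)
    have hd : d ∈ Λ := by by_contra h; exact hcut (hubd h)
    have hℓ' : ℓ ∈ Λ' := Finset.mem_erase.2 ⟨(adj_sℓ.ne).symm, hℓ⟩
    have hd' : d ∈ Λ' := Finset.mem_erase.2 ⟨(adj_sd.ne).symm, hd⟩
    have hsep : ¬ Relation.ReflTransGen (InStep Λ') ℓ d := by
      intro h
      refine hcut (lconn_of_hub (a := ℓ) fun u hu => ?_)
      rcases hcover u hu with h' | h'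
      · exact h'
      · exact h.trans h'
    -- the diagonal cell is outside
    have hc : s + cornerUnit 2 + cornerUnit 3 ∉ Λ := by
      intro hcΛ
      have hc' : s + cornerUnit 2 + cornerUnit 3 ∈ Λ' := Finset.mem_erase.2 ⟨(diag_ne s).1, hcΛ⟩
      refine hsep (Relation.ReflTransGen.head ⟨zdGraph_adj_add_cornerUnit ℓ 3, hℓ', hc'⟩
        (Relation.ReflTransGen.single ⟨?_, hc', hd'⟩))
      rw [add_right_comm]; exact (zdGraph_adj_add_cornerUnit d 2).symm
    -- the two sides
    set A := Λ'.filter fun z => Relation.ReflTransGen (InStep Λ') ℓ z with hA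
    set D := Λ'.filter fun z => Relation.ReflTransGen (InStep Λ') d z with hD
    have hℓA : ℓ ∈ A := Finset.mem_filter.2 ⟨hℓ', Relation.ReflTransGen.refl⟩
    have hdD : d ∈ D := Finset.mem_filter.2 ⟨hd', Relation.ReflTransGen.refl⟩
    have hAsub : A ⊆ Λ' := Finset.filter_subset _ _
    have hDsub : D ⊆ Λ' := Finset.filter_subset _ _
    have hdisj : ∀ z, z ∈ A → z ∈ D → False := fun z hzA hzD =>
      hsep ((Finset.mem_filter.1 hzA).2.trans (lreach_symm (Finset.mem_filter.1 hzD).2))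
    have hcov : ∀ z ∈ Λ', z ∈ A ∨ z ∈ D := fun z hz => by
      rcases hcover z hz with h | h
      · exact Or.inl (Finset.mem_filter.2 ⟨hz, h⟩)
      · exact Or.inr (Finset.mem_filter.2 ⟨hz, h⟩)
    have hnoadj : ∀ a ∈ A, ∀ b ∈ D, ¬ (zdGraph 2).Adj a b := fun a ha b hb hab =>
      hdisj b (Finset.mem_filter.2 ⟨hDsub hb, (Finset.mem_filter.1 ha).2.tail ⟨hab, hAsub ha, hDsub hb⟩⟩) hb
    have hconnA : LConn A := lconn_of_hub (a := ℓ) fun u hu => by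
      have := lreach_filter (Finset.mem_filter.1 hu).2; exact this
    have hconnD : LConn D := lconn_of_hub (a := d) fun u hu => by
      have := lreach_filter (Finset.mem_filter.1 hu).2; exact this
    -- a removable cell in the side `Q` (attached to `s` through `q`), the other side being `R ∋ r`
    have key : ∀ (Q R : Finset (Site 2)) (q r : Site 2), q ∈ Q → r ∈ R → Q ⊆ Λ' → R ⊆ Λ' →
        (∀ z, z ∈ Q → z ∈ R → False) → (∀ z ∈ Λ', z ∈ Q ∨ z ∈ R) → (∀ a ∈ R, ∀ b ∈ Q, ¬ (zdGraph 2).Adj a b) →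
        LConn Q → LConn R → (zdGraph 2).Adj s q → (zdGraph 2).Adj s r → (∃ k : Fin 4, q + cornerUnit k ∉ Λ) →
        (∀ m ∈ Λ, (zdGraph 2).Adj s m → m = q ∨ m = r) →
        ∃ t ∈ Q, (∃ k : Fin 4, t + cornerUnit k ∉ Λ) ∧ LConn (Λ.erase t) := by
      intro Q R q r hq hr hQsub hRsub hdisj' hcov' hnoadj' hconnQ hconnR adj_q adj_r hqexit hnbr'
      by_cases hQ1 : Q.card = 1
      · -- `Q = {q}`: remove `q`
        have hQeq : Q = {q} := by
          obtain ⟨z, hz⟩ := Finset.card_eq_one.1 hQ1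
          rw [hz] at hq ⊢; rw [Finset.mem_singleton] at hq; rw [hq]
        refine ⟨q, hq, hqexit, ?_⟩
        have heq : Λ.erase q = insert s R := by
          ext z
          simp only [Finset.mem_erase, Finset.mem_insert]
          constructor
          · rintro ⟨hzq, hz⟩
            by_cases hzs : z = s
            · exact Or.inl hzs
            · rcases hcov' z (Finset.mem_erase.2 ⟨hzs, hz⟩) with h | h
              · rw [hQeq, Finset.mem_singleton] at h; exact absurd h hzq
              · exact Or.inr h
          · rintro (rfl | hzR)
            · exact ⟨adj_q.ne, hs⟩
            · exact ⟨fun h => hdisj' z (h ▸ hq) hzR, (Finset.mem_erase.1 (hRsub hzR)).2⟩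
        rw [heq]
        exact lconn_insert_of_adj hconnR hr adj_r
      · -- `Q` has at least two cells: induct inside `Q`
        have hQcard : Q.card < n := by
          have := Finset.card_le_card hQsub; rw [hcard'] at this; omega
        have hQ2 : 2 ≤ Q.card := by
          have : 1 ≤ Q.card := Finset.card_pos.2 ⟨q, hq⟩; omega
        obtain ⟨t, htQ, htq, ⟨k, hk⟩, hconnQ'⟩ := IH Q.card hQcard Q rfl hconnQ hQ2 q
        have htΛ' : t ∈ Λ' := hQsub htQ
        obtain ⟨hts, htΛ⟩ := Finset.mem_erase.1 htΛ'
        refine ⟨t, htQ, ?_, ?_⟩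
        · -- exit in `Λ`
          refine ⟨k, fun hkΛ => ?_⟩
          by_cases hks : t + cornerUnit k = s
          · have hadj : (zdGraph 2).Adj s t := by rw [← hks]; exact (zdGraph_adj_add_cornerUnit t k).symm
            rcases hnbr' t htΛ hadj with rfl | rfl
            · exact htq rfl
            · exact hdisj' _ htQ hr
          · have hkΛ' : t + cornerUnit k ∈ Λ' := Finset.mem_erase.2 ⟨hks, hkΛ⟩
            rcases hcov' _ hkΛ' with h | h
            · exact hk h
            · exact hnoadj' _ h t htQ (zdGraph_adj_add_cornerUnit t k).symm
        · -- connectivity: `Λ ∖ {t} = insert s ((Q ∖ {t}) ∪ R)`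
          have heq : Λ.erase t = insert s (Q.erase t ∪ R) := by
            ext z
            simp only [Finset.mem_erase, Finset.mem_insert, Finset.mem_union]
            constructor
            · rintro ⟨hzt, hz⟩
              by_cases hzs : z = s
              · exact Or.inl hzs
              · rcases hcov' z (Finset.mem_erase.2 ⟨hzs, hz⟩) with h | h
                · exact Or.inr (Or.inl ⟨hzt, h⟩)
                · exact Or.inr (Or.inr h)
            · rintro (rfl | ⟨hzt, hzQ⟩ | hzR)
              · exact ⟨fun h => hts h.symm, hs⟩
              · exact ⟨hzt, (Finset.mem_erase.1 (hQsub hzQ)).2⟩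
              · exact ⟨fun h => hdisj' z (h ▸ htQ) hzR, (Finset.mem_erase.1 (hRsub hzR)).2⟩
          rw [heq]
          exact lconn_insert_union hconnQ' hconnR (Finset.mem_erase.2 ⟨fun h => htq h.symm, hq⟩) hr adj_q adj_r
    -- apply `key` to both sides
    have hdexit : ∃ k : Fin 4, d + cornerUnit k ∉ Λ := ⟨2, by rw [hddef, add_right_comm]; exact hc⟩
    have hℓexit : ∃ k : Fin 4, ℓ + cornerUnit k ∉ Λ := ⟨1, Eupleft⟩
    have hnbrDA : ∀ m ∈ Λ, (zdGraph 2).Adj s m → m = d ∨ m = ℓ := fun m hm h => (hnbr m hm h).symm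
    obtain ⟨tD, htD, hexD, hcD⟩ := key D A d ℓ hdD hℓA hDsub hAsub (fun z hzD hzA => hdisj z hzA hzD)
      (fun z hz => (hcov z hz).symm) (fun a ha b hb => hnoadj a ha b hb) hconnD hconnA adj_sd adj_sℓ hdexit hnbrDA
    obtain ⟨tA, htA, hexA, hcA⟩ := key A D ℓ d hℓA hdD hAsub hDsub hdisj hcov
      (fun a ha b hb hab => hnoadj b hb a ha hab.symm) hconnA hconnD adj_sℓ adj_sd hℓexit hnbr
    by_cases hx : x = tD
    · refine ⟨tA, (Finset.mem_erase.1 (hAsub htA)).2, fun h => hdisj tA htA (h ▸ hx ▸ htD), hexA, hcA⟩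
    · exact ⟨tD, (Finset.mem_erase.1 (hDsub htD)).2, fun h => hx h.symm, hexD, hcD⟩


end Literature.Probability.LatticeModels
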